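import Summits.BirchSwinnertonDyer.BirchSwinnertonDyer.Theorems.TwoAdicConverseFrobeniusParityTwoDivisionRoot
import Literature.NumberTheory.EllipticCurves.Greenberg1999.TwoTorsionOddIsogenyDualProofs
import Literature.NumberTheory.EllipticCurves.MinimalModelReduction
import HarnessLib

/-!
# Route `TwoAdicConverse` (rung S3), crux `OrdLambdaHalfAtTwo` (item 19556): the COMPLETE local criterion for `4 ∣ #W̃(𝔽_ℓ)` —
# K0 read at a root of `ψ₂²` MODULO `ℓ` (no rational `2`-torsion needed)

Cell `bsd-2adic`, seat `bsd-2adic-conv-1` (GEN 21). THEOREMS ONLY — no named fact, no definition, nothing conditional. K0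
(`TwoAdicConverseModFourTraceOneTwoTorsionPoint`) reads `a_ℓ mod 4` from a RATIONAL point of order `2`; the S₃-image strata of
item 19556 (lines L3 `five-flag-plane-two`, reserve `elliptic-shadow-two`) have none. Here the same mechanism is run at a root `r̄` of
`ψ₂²` in `𝔽_ℓ` itself: move `(r̄, ȳ)` to the origin over `𝔽_ℓ` (change of variables `(1, r̄, −a₁/2, ȳ)`; coefficients by the tree's
`four_mul_a₂_of_isTwoTorsionNF_smul` / `two_mul_a₄_of_isTwoTorsionNF_smul`) and apply Part 1's
`four_dvd_natCard_point_iff_isSquare`. Result, for EVERY globally minimal `W/ℚ` and odd good `ℓ`: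

* `exists_twoTorsionNF_of_root` — field level: an elliptic `V` over `F` (`2 ≠ 0`) with a root `r` of `ψ_V` is `F`-isomorphic to
  `y² = x³ + a′x² + b′x` with `2b′ = 6r² + b₂r + b₄`, `4a′ = b₂ + 12r`, same `Δ`, same number of points;
* `four_dvd_natCard_point_iff_of_root` — over a FINITE field: `4 ∣ #V(𝔽) ⟺ 2(6r² + b₂r + b₄)` is a square `∨ Δ` is a square;
* **`four_dvd_reductionPointCount_iff_exists_root`** — `4 ∣ #W̃(𝔽_ℓ) ⟺ ∃ r̄ ∈ 𝔽_ℓ`, `ψ₂²(r̄) = 0 ∧ (2(6r̄² + b₂r̄ + b₄)` is a square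
  mod `ℓ ∨ (Δ/ℓ) = 1)`; with `…FrobeniusParity…`: at a prime with `(Δ/ℓ) = −1` (Frobenius a transposition on `E[2]`; the unique
  `𝔽_ℓ`-rational `2`-torsion point `P̄`), **`a_ℓ ≡ ℓ + 1 (mod 4)` iff `P̄` is halvable in `W̃(𝔽_ℓ)`, i.e. iff `2(6r̄² + b₂r̄ + b₄)` is a
  square mod `ℓ`** (`four_dvd_succ_sub_frobeniusTrace_iff_of_not_isSquare_discr`).

HONEST FRAMING: elementary local algebra; nothing about `λ` or BSD; items 19556 / 19218 stay OPEN; BSD is not proved by any of this.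
PARTITION (D-0054): none — RANK axis (S3). References: A. W. Knapp, *Elliptic Curves* (1992), Thm. 4.2 [Knapp1993]; J. H. Silverman,
*AEC* (2009), III.1, III.2.3, X.4.9 [SilvermanAEC2009].
-/

set_option linter.dupNamespace false
set_option autoImplicit false

noncomputable section

open scoped Classical
open WeierstrassCurve Literature.NumberTheory.EllipticCurves Literature.NumberTheory.EllipticCurves.Greenberg1999

namespace Summit.BirchSwinnertonDyer.BirchSwinnertonDyer.Theorems.TwoAdicTwistConverse

/-! ## §1. Two-torsion normal form at a root of `ψ₂²`, over a field with `2 ≠ 0` -/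

section Field

variable {F : Type*} [Field F] (V : WeierstrassCurve F) [V.IsElliptic]

/-- **Normal form at a root.** If `ψ_V(r) = 4r³ + b₂r² + 2b₄r + b₆ = 0` (`2 ≠ 0`), then for the point `(r, ȳ)` of order `2` the
change of variables `(1, r, −a₁/2, ȳ)` yields an elliptic `V′ : y² = x³ + a′x² + b′x` with `#V′(F) = #V(F)`,
`2b′ = 6r² + b₂r + b₄`, `4a′ = b₂ + 12r` and `Δ(V′) = Δ(V)`. [cite: SilvermanAEC2009, III.1 Table 3.1 and X.4.9] -/
theorem exists_twoTorsionNF_of_root (h2 : (2 : F) ≠ 0) {r : F}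
    (hr : 4 * r ^ 3 + V.b₂ * r ^ 2 + 2 * V.b₄ * r + V.b₆ = 0) :
    ∃ (V' : WeierstrassCurve F) (_ : V'.IsTwoTorsionNF) (_ : V'.IsElliptic),
      Nat.card V'.toAffine.Point = Nat.card V.toAffine.Point ∧
      2 * V'.a₄ = 6 * r ^ 2 + V.b₂ * r + V.b₄ ∧ 4 * V'.a₂ = V.b₂ + 12 * r ∧ V'.Δ = V.Δ := by
  obtain ⟨y, h2y⟩ : ∃ y : F, 2 * y + V.a₁ * r + V.a₃ = 0 := ⟨-(V.a₁ * r + V.a₃) / 2, by field_simp; ring⟩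
  have h4 : (4 : F) ≠ 0 := by rw [show (4 : F) = 2 * 2 by norm_num]; exact mul_ne_zero h2 h2
  have heq : V.toAffine.Equation r y := by
    rw [Affine.equation_iff]
    simp only [WeierstrassCurve.toAffine_a₁, WeierstrassCurve.toAffine_a₂, WeierstrassCurve.toAffine_a₃,
      WeierstrassCurve.toAffine_a₄, WeierstrassCurve.toAffine_a₆]
    simp only [WeierstrassCurve.b₂, WeierstrassCurve.b₄, WeierstrassCurve.b₆] at hr
    apply mul_left_cancel₀ h4
    linear_combination -hr + (2 * y + V.a₁ * r + V.a₃) * h2y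
  let C : VariableChange F := ⟨1, r, -V.a₁ / 2, y⟩
  have hCu : ((C.u⁻¹ : Fˣ) : F) = 1 := by simp [C]
  have hV₁ : (C • V).a₁ = 0 := by
    simp only [variableChange_a₁, hCu, C]; field_simp; ring
  have hV₃ : (C • V).a₃ = 0 := by
    simp only [variableChange_a₃, hCu, C]; linear_combination h2y
  have hV₆ : (C • V).a₆ = 0 := by
    rw [Affine.equation_iff] at heq
    simp only [WeierstrassCurve.toAffine_a₁, WeierstrassCurve.toAffine_a₂, WeierstrassCurve.toAffine_a₃,
      WeierstrassCurve.toAffine_a₄, WeierstrassCurve.toAffine_a₆] at heq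
    simp only [variableChange_a₆, hCu, C]; linear_combination -heq
  haveI hNF : (C • V).IsTwoTorsionNF := ⟨hV₁, hV₃, hV₆⟩
  refine ⟨C • V, hNF, inferInstance, natCard_point_smul C V, ?_, ?_, ?_⟩
  · have h := two_mul_a₄_of_isTwoTorsionNF_smul V C
    rw [hCu, one_pow, one_mul] at h
    rw [h]; simp only [C]; ring
  · have h := four_mul_a₂_of_isTwoTorsionNF_smul V C
    rw [hCu, one_pow, one_mul] at h
    exact h
  · rw [variableChange_Δ, hCu, one_pow, one_mul]

/-- **`4 ∣ #V(𝔽)` at a root `r` of `ψ_V`** (finite field, `2 ≠ 0`): iff `2(6r² + b₂r + b₄)` is a square (the `𝔽`-rational point of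
order `2` over `r` is halvable) or `Δ` is a square (full `2`-torsion over `𝔽`). [cite: Knapp1993, Thm. 4.2] [cite: SilvermanAEC2009, X.4.9] -/
theorem four_dvd_natCard_point_iff_of_root [Finite F] (h2 : (2 : F) ≠ 0) {r : F}
    (hr : 4 * r ^ 3 + V.b₂ * r ^ 2 + 2 * V.b₄ * r + V.b₆ = 0) :
    4 ∣ Nat.card V.toAffine.Point ↔ IsSquare (2 * (6 * r ^ 2 + V.b₂ * r + V.b₄)) ∨ IsSquare V.Δ := by
  obtain ⟨V', hNF, hE', hcard, hb, -, hΔ⟩ := exists_twoTorsionNF_of_root V h2 hr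
  have h4 : (4 : F) ≠ 0 := by rw [show (4 : F) = 2 * 2 by norm_num]; exact mul_ne_zero h2 h2
  rw [← hcard, four_dvd_natCard_point_iff_isSquare V', ← hΔ, Δ_of_isTwoTorsionNF, ← hb,
    show (2 : F) * (2 * V'.a₄) = 2 ^ 2 * V'.a₄ by ring,
    show (16 : F) * V'.a₄ ^ 2 * (V'.a₂ ^ 2 - 4 * V'.a₄) = (4 * V'.a₄) ^ 2 * (V'.a₂ ^ 2 - 4 * V'.a₄) by ring,
    isSquare_sq_mul_iff h2, isSquare_sq_mul_iff (mul_ne_zero h4 (a₄_ne_zero V'))]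

end Field

/-! ## §2. Globally minimal curves over `ℚ`: the complete criterion at an odd good prime -/

section Rat

variable (W : WeierstrassCurve ℚ) [W.IsElliptic] [W.IsGloballyMinimal] (ℓ : ℕ) [Fact ℓ.Prime]

omit [W.IsElliptic] in
/-- **`4 ∣ #W̃(𝔽_ℓ) ⟺ ∃` a root `r̄` of `ψ₂²` mod `ℓ` with `2(6r̄² + b₂r̄ + b₄)` a square mod `ℓ` or `(Δ/ℓ) = 1`** — for EVERY globally
minimal `W/ℚ` and odd good prime `ℓ` (`b₂, b₄, b₆` the integer invariants, `Δ` the minimal discriminant). [cite: Knapp1993, Thm. 4.2]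
[cite: SilvermanAEC2009, III.2.3 and X.4.9] -/
theorem four_dvd_reductionPointCount_iff_exists_root (hℓ : ℓ ≠ 2) (hgood : W.HasGoodReductionAtPrime ℓ) :
    4 ∣ W.reductionPointCount ℓ ↔ ∃ r : ZMod ℓ,
      4 * r ^ 3 + ((integralModelInt W).b₂ : ZMod ℓ) * r ^ 2 + 2 * ((integralModelInt W).b₄ : ZMod ℓ) * r +
          ((integralModelInt W).b₆ : ZMod ℓ) = 0 ∧
        (IsSquare (2 * (6 * r ^ 2 + ((integralModelInt W).b₂ : ZMod ℓ) * r + ((integralModelInt W).b₄ : ZMod ℓ))) ∨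
          IsSquare ((minimalDiscriminantInt W : ZMod ℓ))) := by
  have hΔℓ : ¬ (ℓ : ℤ) ∣ minimalDiscriminantInt W := not_dvd_minimalDiscriminantInt_of_hasGoodReductionAtPrime' W ℓ hgood
  haveI hE : (reductionModPrime W ℓ).IsElliptic := isElliptic_reductionModPrime W hΔℓ
  have h2F : (2 : ZMod ℓ) ≠ 0 := by
    intro h
    have h' : ((2 : ℕ) : ZMod ℓ) = 0 := by exact_mod_cast h
    rw [ZMod.natCast_eq_zero_iff] at h'
    exact hℓ ((Nat.prime_dvd_prime_iff_eq Fact.out Nat.prime_two).mp h')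
  have hb₂ : ((integralModelInt W).b₂ : ZMod ℓ) = (reductionModPrime W ℓ).b₂ := by
    simp only [reductionModPrime, map_b₂, eq_intCast]
  have hb₄ : ((integralModelInt W).b₄ : ZMod ℓ) = (reductionModPrime W ℓ).b₄ := by
    simp only [reductionModPrime, map_b₄, eq_intCast]
  have hb₆ : ((integralModelInt W).b₆ : ZMod ℓ) = (reductionModPrime W ℓ).b₆ := by
    simp only [reductionModPrime, map_b₆, eq_intCast]
  have hΔ : ((minimalDiscriminantInt W : ℤ) : ZMod ℓ) = (reductionModPrime W ℓ).Δ := by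
    simp only [reductionModPrime, map_Δ, eq_intCast, minimalDiscriminantInt]
  rw [reductionPointCount_eq_natCard_point, hb₂, hb₄, hb₆, hΔ]
  constructor
  · intro h4
    obtain ⟨r, hr⟩ := (two_dvd_natCard_point_iff_exists_root (reductionModPrime W ℓ) h2F).mp
      ((show (2 : ℕ) ∣ 4 by norm_num).trans h4)
    exact ⟨r, hr, (four_dvd_natCard_point_iff_of_root (reductionModPrime W ℓ) h2F hr).mp h4⟩
  · rintro ⟨r, hr, h⟩
    exact (four_dvd_natCard_point_iff_of_root (reductionModPrime W ℓ) h2F hr).mpr h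

omit [W.IsElliptic] in
/-- **At a prime with `(Δ/ℓ) = −1`** (Frobenius a transposition on `E[2]`: exactly one `𝔽_ℓ`-rational point `P̄` of order `2`),
**`a_ℓ ≡ ℓ + 1 (mod 4)` iff `P̄` is halvable**: `4 ∣ ℓ + 1 − a_ℓ ⟺ ∃` root `r̄` of `ψ₂²` mod `ℓ` with `2(6r̄² + b₂r̄ + b₄)` a square
mod `ℓ`. [cite: Knapp1993, Thm. 4.2] [cite: SilvermanAEC2009, V.2.3.1] -/
theorem four_dvd_succ_sub_frobeniusTrace_iff_of_not_isSquare_discr (hℓ : ℓ ≠ 2)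
    (hgood : W.HasGoodReductionAtPrime ℓ) (hΔ : ¬ IsSquare ((minimalDiscriminantInt W : ZMod ℓ))) :
    (4 : ℤ) ∣ (ℓ : ℤ) + 1 - W.frobeniusTrace ℓ ↔ ∃ r : ZMod ℓ,
      4 * r ^ 3 + ((integralModelInt W).b₂ : ZMod ℓ) * r ^ 2 + 2 * ((integralModelInt W).b₄ : ZMod ℓ) * r +
          ((integralModelInt W).b₆ : ZMod ℓ) = 0 ∧
        IsSquare (2 * (6 * r ^ 2 + ((integralModelInt W).b₂ : ZMod ℓ) * r + ((integralModelInt W).b₄ : ZMod ℓ))) := by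
  rw [WeierstrassCurve.frobeniusTrace, sub_sub_cancel,
    show ((4 : ℤ) ∣ (W.reductionPointCount ℓ : ℤ)) ↔ 4 ∣ W.reductionPointCount ℓ from Int.natCast_dvd_natCast,
    four_dvd_reductionPointCount_iff_exists_root W ℓ hℓ hgood]
  simp only [hΔ, or_false]

end Rat

end Summit.BirchSwinnertonDyer.BirchSwinnertonDyer.Theorems.TwoAdicTwistConverse

end
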